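import Summits.QuantumFields.YangMills.Theorems.BalabanLadderROTTiltSplit
import HarnessLib

/-!
# BalabanLadder ▸ `ROT` — the AXIS cell: `PeriodCell` reproduces the tree's straight-torus objects (consistency)

Supporting file for `stmt-QuantumFields-20042` (`ROT`), count-neutral (cell ym-beyond, seat p4 = Y2).  It closes the one
honest gap left open in `BalabanLadderROTSkewTorus` §«conventions»: the claim that the skew-torus Wilson theory
(`PeriodCell.measure/mean/moment/dist`) with the AXIS period lattice `P = (2L+1)ℤ⁴` and the centred transversal
`reps = box 4 L` IS the tree's straight-torus theory (`wilsonMeasure (d := 4) (L := 2L+1)`, `wilsonTorusMean`,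
`torusMoment`, `latticeDist`).  Everything is an honest transport along the measurable equivalence of configuration
spaces induced by «centred representative ↦ residue class» (`ZMod.valMinAbs`):

* §1 `map_withDensity_comp_equiv` — densities transport along a measurable equivalence (generic lemma);
* §2 `axisCell L : PeriodCell 4` — `P = (2L+1)ℤ⁴`, `reps = box 4 L`, `red` = coordinatewise centred reduction;
* §3 `siteEquiv/edgeEquiv/configEquiv` and the dictionary: `plaquetteHolonomy ∘ configEquiv = holonomy`,
  `wilsonAction ∘ configEquiv = action`, `weight ↦ wilsonWeight`, `partitionZ = partitionFunction`,
  `measure ↦ wilsonMeasure`, `torusLift ∘ configEquiv = lift`;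
* §4 the identities `mean_axisCell : (axisCell L).mean ρ β O = wilsonTorusMean ρ β L O`,
  `moment_axisCell : (axisCell L).moment … x = torusMoment … x`, `dist_axisCell : (axisCell L).dist ρ β (a • siteToE ·) O m n = latticeDist ρ β L a O m n`;
* §5 the COSTUME CHECK of the tilt split, in the kernel: with the axis cell the tilt bracket vanishes identically
  (`tiltInsensitivityOn_axisCell`) and the regularisation bracket is literally King's defect
  (`tiltedRegComparisonOn_axisCell_iff : TiltedRegComparisonOn G r a axisCell θ S ↔ LatticeKingWardOn G r a {θ} S`) —
  so the split `KingOnClass ⇐ NROT3 ∧ TI` carries content ONLY through the choice of a genuinely skew (fitted, tilted) cell,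
  exactly as `BalabanLadderROTTiltSplit` §«honest reading» says in words.

WHAT THIS IS NOT: no claim about `ROT`, `NROT3`, `TI` or the summit; a consistency / dictionary file (0 sorry).
-/

set_option autoImplicit false

noncomputable section

open scoped SchwartzMap BigOperators ENNReal
open MeasureTheory Filter Topology Real
open Literature.MathematicalPhysics.QuantumFieldTheory Literature.MathematicalPhysics.QuantumLattice
open Literature.MathematicalPhysics.AQFT Literature.Probability.LatticeModels
open Summit.QuantumFields.YangMills.Cruxes.OSLegsFromFemtoAndGap.DlrCollarTransfer
open Summit.QuantumFields.YangMills.Cruxes.OSLegsAtWeakCouplingC.Sketch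
open Summit.QuantumFields.YangMills.Cruxes.OSLegsAtWeakCouplingC.Y2Bridge
open Summit.QuantumFields.YangMills.Theorems.OSLegsFromFemtoAndGap (torusMoment latticeDist)
open Summit.QuantumFields.YangMills.Theorems.NPointIsotropy.Negative (E4)

namespace Summit.QuantumFields.YangMills.Theorems.ROT

/-! ## §1 Densities transport along a measurable equivalence -/

/-- `(μ.withDensity (d ∘ Φ)).map Φ = (μ.map Φ).withDensity d` for a measurable equivalence `Φ` (no measurability of `d`
needed: both sides are set-lintegrals and `Φ` is a measurable embedding). -/
theorem map_withDensity_comp_equiv {α β : Type*} [MeasurableSpace α] [MeasurableSpace β] (Φ : α ≃ᵐ β)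
    (μ : Measure α) (d : β → ℝ≥0∞) :
    (μ.withDensity fun x => d (Φ x)).map Φ = (μ.map Φ).withDensity d := by
  ext s hs
  rw [Φ.map_apply, withDensity_apply _ (Φ.measurable hs), withDensity_apply _ hs,
    Φ.measurableEmbedding.restrict_map, lintegral_map_equiv]

/-! ## §2 The axis cell `ℤ⁴/(2L+1)ℤ⁴` with the centred transversal `box 4 L` -/

/-- Centred coordinatewise representatives of residues lie in the box `[-L, L]⁴`. -/
theorem valMinAbs_mem_box (L : ℕ) (z : Fin 4 → ZMod (2 * L + 1)) :
    (fun i => (z i).valMinAbs) ∈ box 4 L := by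
  rw [mem_box]
  intro i
  have h := ZMod.natAbs_valMinAbs_le (z i)
  have hL : (2 * L + 1) / 2 = L := by omega
  rw [hL] at h
  have h' : |(z i).valMinAbs| ≤ (L : ℤ) := by
    rw [Int.abs_eq_natAbs]; exact_mod_cast h
  exact abs_le.1 h'

/-- Coordinatewise centred reduction mod `2L+1`. -/
def axisRed (L : ℕ) (x : Site 4) : Site 4 := fun i => ((x i : ZMod (2 * L + 1))).valMinAbs

/-- The centred reduction in coordinates. [folklore] -/
theorem axisRed_apply (L : ℕ) (x : Site 4) (i : Fin 4) :
    axisRed L x i = ((x i : ZMod (2 * L + 1))).valMinAbs := rfl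

/-- The centred reduction lands in the box. [folklore] -/
theorem axisRed_mem_box (L : ℕ) (x : Site 4) : axisRed L x ∈ box 4 L :=
  valMinAbs_mem_box L fun i => (x i : ZMod (2 * L + 1))

/-- The axis period lattice `(2L+1)ℤ⁴`. -/
def axisPeriods (L : ℕ) : AddSubgroup (Site 4) where
  carrier := {p | ∀ i, ((2 * L + 1 : ℕ) : ℤ) ∣ p i}
  add_mem' := fun {p q} hp hq i => by simpa using dvd_add (hp i) (hq i)
  zero_mem' := fun i => by simp
  neg_mem' := fun {p} hp i => by simpa using hp i

/-- Membership in the axis period lattice: every coordinate divisible by `2L+1`. [folklore] -/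
theorem mem_axisPeriods {L : ℕ} {p : Site 4} : p ∈ axisPeriods L ↔ ∀ i, ((2 * L + 1 : ℕ) : ℤ) ∣ p i := Iff.rfl

/-- The reduction differs from the site by a period. [folklore] -/
theorem axisRed_sub_mem (L : ℕ) (x : Site 4) : axisRed L x - x ∈ axisPeriods L := fun i => by
  rw [Pi.sub_apply, ← ZMod.intCast_zmod_eq_zero_iff_dvd, Int.cast_sub, axisRed_apply, ZMod.coe_valMinAbs, sub_self]

/-- The reduction is invariant under the periods. [folklore] -/
theorem axisRed_add (L : ℕ) (x p : Site 4) (hp : p ∈ axisPeriods L) : axisRed L (x + p) = axisRed L x := by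
  funext i
  rw [axisRed_apply, axisRed_apply, Pi.add_apply, Int.cast_add,
    (ZMod.intCast_zmod_eq_zero_iff_dvd _ _).2 (hp i), add_zero]

/-- The reduction fixes the box. [folklore] -/
theorem axisRed_eq_self (L : ℕ) (x : Site 4) (hx : x ∈ box 4 L) : axisRed L x = x := by
  funext i
  obtain ⟨h1, h2⟩ := (mem_box.1 hx) i
  rw [axisRed_apply, ZMod.valMinAbs_spec]
  refine ⟨rfl, ?_⟩
  rw [Set.mem_Ioc]
  push_cast
  omega

/-- The AXIS cell: the straight torus `ℤ⁴/(2L+1)ℤ⁴` presented by the centred transversal `box 4 L = [-L, L]⁴`. -/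
def axisCell (L : ℕ) : PeriodCell 4 where
  P := axisPeriods L
  reps := box 4 L
  red := axisRed L
  red_mem := axisRed_mem_box L
  red_eq_self := axisRed_eq_self L
  red_sub_mem := axisRed_sub_mem L
  red_add := axisRed_add L

/-- The periods of the axis cell. [folklore] -/
@[simp] theorem axisCell_P (L : ℕ) : (axisCell L).P = axisPeriods L := rfl

/-- The transversal of the axis cell is the centred box. [folklore] -/
@[simp] theorem axisCell_reps (L : ℕ) : (axisCell L).reps = box 4 L := rfl

/-- The reduction of the axis cell. [folklore] -/
@[simp] theorem axisCell_red (L : ℕ) : (axisCell L).red = axisRed L := rfl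

/-! ## §3 The dictionary with the tree's straight torus `Fin 4 → ZMod (2L+1)` -/

/-- Centred representatives `↔` residues. -/
def siteEquiv (L : ℕ) : (axisCell L).TSite ≃ (Fin 4 → ZMod (2 * L + 1)) where
  toFun x := fun i => (((x : Site 4) i : ℤ) : ZMod (2 * L + 1))
  invFun z := ⟨fun i => (z i).valMinAbs, valMinAbs_mem_box L z⟩
  left_inv x := Subtype.ext (axisRed_eq_self L x x.2)
  right_inv z := funext fun i => ZMod.coe_valMinAbs (z i)

/-- `siteEquiv` in coordinates: reduction mod `2L+1`. [folklore] -/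
@[simp] theorem siteEquiv_apply (L : ℕ) (x : (axisCell L).TSite) (i : Fin 4) :
    siteEquiv L x i = (((x : Site 4) i : ℤ) : ZMod (2 * L + 1)) := rfl

/-- `siteEquiv` of a representative is the plain reduction mod `2L+1`. [folklore] -/
theorem siteEquiv_toRep (L : ℕ) (y : Site 4) :
    siteEquiv L ((axisCell L).toRep y) = fun i => ((y i : ℤ) : ZMod (2 * L + 1)) := by
  funext i
  rw [siteEquiv_apply, PeriodCell.coe_toRep, axisCell_red, axisRed_apply, ZMod.coe_valMinAbs]

/-- Neighbours go to neighbours under `siteEquiv`. [folklore] -/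
theorem siteEquiv_shift (L : ℕ) (x : (axisCell L).TSite) (i : Fin 4) :
    siteEquiv L ((axisCell L).shift x i) =
      Literature.MathematicalPhysics.QuantumFieldTheory.Site.shift (siteEquiv L x) i := by
  funext k
  rw [PeriodCell.shift, siteEquiv_toRep]
  simp only [Literature.MathematicalPhysics.QuantumFieldTheory.Site.shift, Pi.add_apply, Int.cast_add,
    siteEquiv_apply]
  by_cases hk : k = i
  · subst hk; simp
  · simp [Pi.single_eq_of_ne hk]

/-- Edges of the axis cell `↔` edges of the tree's torus. -/
def edgeEquiv (L : ℕ) : (axisCell L).TEdge ≃ Edge 4 (2 * L + 1) :=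
  (siteEquiv L).prodCongr (Equiv.refl (Fin 4))

/-- `edgeEquiv` unfolded. [folklore] -/
@[simp] theorem edgeEquiv_apply (L : ℕ) (x : (axisCell L).TSite) (i : Fin 4) :
    edgeEquiv L (x, i) = (siteEquiv L x, i) := rfl

variable {G : Type} [Group G] [TopologicalSpace G] [IsTopologicalGroup G] [CompactSpace G]
  [MeasurableSpace G] [BorelSpace G] {N : ℕ} (ρ : G →* Matrix (Fin N) (Fin N) ℂ)

/-- Configurations of the axis cell `≃ᵐ` gauge configurations of the tree's torus (reindexing along `edgeEquiv`). -/
def configEquiv (L : ℕ) : (axisCell L).Config G ≃ᵐ GaugeConfig 4 (2 * L + 1) G :=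
  MeasurableEquiv.piCongrLeft (fun _ : Edge 4 (2 * L + 1) => G) (edgeEquiv L)

omit [Group G] [TopologicalSpace G] [IsTopologicalGroup G] [CompactSpace G] [BorelSpace G] in
/-- `configEquiv` unfolded. [folklore] -/
@[simp] theorem configEquiv_apply (L : ℕ) (U : (axisCell L).Config G) (x : (axisCell L).TSite) (i : Fin 4) :
    configEquiv L U (siteEquiv L x, i) = U (x, i) := by
  rw [← edgeEquiv_apply]
  exact MeasurableEquiv.piCongrLeft_apply_apply (β := fun _ : Edge 4 (2 * L + 1) => G) (edgeEquiv L) U (x, i)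

omit [TopologicalSpace G] [IsTopologicalGroup G] [CompactSpace G] [BorelSpace G] in
/-- Plaquette holonomies correspond. -/
theorem plaquetteHolonomy_configEquiv (L : ℕ) (U : (axisCell L).Config G) (x : (axisCell L).TSite) (i j : Fin 4) :
    plaquetteHolonomy (configEquiv L U) (siteEquiv L x) i j = (axisCell L).holonomy U x i j := by
  simp only [plaquetteHolonomy, PeriodCell.holonomy, ← siteEquiv_shift, configEquiv_apply]

omit [TopologicalSpace G] [IsTopologicalGroup G] [CompactSpace G] [BorelSpace G] in
/-- Wilson actions correspond. -/
theorem wilsonAction_configEquiv (L : ℕ) (U : (axisCell L).Config G) :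
    wilsonAction ρ (configEquiv L U) = (axisCell L).action ρ U := by
  unfold wilsonAction PeriodCell.action
  exact (Fintype.sum_equiv ((siteEquiv L).prodCongr (Equiv.refl _)) _ _ fun p => by
    simp only [Equiv.prodCongr_apply, Equiv.coe_refl, Prod.map_fst, Prod.map_snd, id_eq,
      plaquetteHolonomy_configEquiv]).symm

/-- The product Haar measures correspond. -/
theorem map_configEquiv_pi (L : ℕ) :
    (Measure.pi fun _ : (axisCell L).TEdge => haarProbability G).map (configEquiv L) =
      Measure.pi fun _ : Edge 4 (2 * L + 1) => haarProbability G :=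
  Measure.pi_map_piCongrLeft (edgeEquiv L) fun _ : Edge 4 (2 * L + 1) => haarProbability G

/-- Wilson weights correspond. -/
theorem map_configEquiv_weight (L : ℕ) (β : ℝ) :
    ((axisCell L).weight ρ β).map (configEquiv L) = wilsonWeight (d := 4) (L := 2 * L + 1) ρ β := by
  have hd : (fun U : (axisCell L).Config G => ENNReal.ofReal (Real.exp (-β * (axisCell L).action ρ U))) =
      fun U => ENNReal.ofReal (Real.exp (-β * wilsonAction ρ (configEquiv L U))) := by
    funext U; rw [wilsonAction_configEquiv]
  calc ((axisCell L).weight ρ β).map (configEquiv L)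
      = ((Measure.pi fun _ : (axisCell L).TEdge => haarProbability G).withDensity
          fun U => ENNReal.ofReal (Real.exp (-β * wilsonAction ρ (configEquiv L U)))).map (configEquiv L) := by
        rw [PeriodCell.weight, hd]
    _ = ((Measure.pi fun _ : (axisCell L).TEdge => haarProbability G).map (configEquiv L)).withDensity
          fun U' => ENNReal.ofReal (Real.exp (-β * wilsonAction ρ U')) :=
        map_withDensity_comp_equiv (configEquiv L) _ fun U' => ENNReal.ofReal (Real.exp (-β * wilsonAction ρ U'))
    _ = wilsonWeight (d := 4) (L := 2 * L + 1) ρ β := by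
        rw [map_configEquiv_pi]
        rfl

/-- Partition functions agree. -/
theorem partitionZ_axisCell (L : ℕ) (β : ℝ) :
    (axisCell L).partitionZ (G := G) ρ β = partitionFunction (d := 4) (L := 2 * L + 1) ρ β := by
  rw [PeriodCell.partitionZ, partitionFunction, ← map_configEquiv_weight, (configEquiv L).map_apply, Set.preimage_univ]

/-- Wilson probability measures correspond. -/
theorem map_configEquiv_measure (L : ℕ) (β : ℝ) :
    ((axisCell L).measure ρ β).map (configEquiv L) = wilsonMeasure (d := 4) (L := 2 * L + 1) ρ β := by
  rw [PeriodCell.measure, Measure.map_smul, map_configEquiv_weight, partitionZ_axisCell]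
  rfl

/-- Change of variables for expectations. -/
theorem integral_axisCell_comp_configEquiv (L : ℕ) (β : ℝ) (f : GaugeConfig 4 (2 * L + 1) G → ℝ) :
    ∫ U, f (configEquiv L U) ∂((axisCell L).measure ρ β) =
      ∫ U', f U' ∂(wilsonMeasure (d := 4) (L := 2 * L + 1) ρ β) := by
  rw [← map_configEquiv_measure, integral_map_equiv]

omit [Group G] [TopologicalSpace G] [IsTopologicalGroup G] [CompactSpace G] [BorelSpace G] in
/-- The periodic lifts correspond: `torusLift (2L+1) ∘ configEquiv = PeriodCell.lift`. -/
theorem torusLift_configEquiv (L : ℕ) (U : (axisCell L).Config G) :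
    torusLift (2 * L + 1) (configEquiv L U) = (axisCell L).lift U := by
  funext e
  show configEquiv L U (fun i => ((e.1 i : ℤ) : ZMod (2 * L + 1)), e.2) = U ((axisCell L).toRep e.1, e.2)
  rw [← siteEquiv_toRep, configEquiv_apply]

/-! ## §4 The identities: mean, moments, moment distributions -/

/-- The skew-torus mean on the axis cell IS the tree's torus mean. -/
theorem mean_axisCell (L : ℕ) (β : ℝ) (O : LGConfig 4 G → ℝ) :
    (axisCell L).mean ρ β O = wilsonTorusMean ρ β L O := by
  unfold PeriodCell.mean wilsonTorusMean
  simp_rw [← torusLift_configEquiv]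
  exact integral_axisCell_comp_configEquiv ρ L β fun U' => O (torusLift (2 * L + 1) U')

/-- The skew-torus centred moments on the axis cell ARE the tree's torus moments. -/
theorem moment_axisCell (L : ℕ) (β : ℝ) (O : LGConfig 4 G → ℝ) (m : ℝ) {n : ℕ} (x : Fin n → Site 4) :
    (axisCell L).moment ρ β O m x = torusMoment ρ β L O m x := by
  unfold PeriodCell.moment torusMoment
  simp_rw [← torusLift_configEquiv]
  exact integral_axisCell_comp_configEquiv ρ L β fun U' => ∏ i, (O (configShift (-(x i)) (torusLift (2 * L + 1) U')) - m)

/-- The skew-torus moment distribution on the axis cell with the straight embedding `x ↦ a • x` IS `latticeDist`. -/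
theorem dist_axisCell (L : ℕ) (β a : ℝ) (O : LGConfig 4 G → ℝ) (m : ℝ) (n : ℕ) :
    (axisCell L).dist ρ β (fun x => a • siteToE x) O m n = latticeDist ρ β L a O m n := by
  unfold PeriodCell.dist latticeDist
  simp_rw [moment_axisCell]
  rfl

/-- `R · (R⁻¹ · F) = F` for the action of isometries on test functions. -/
theorem linActMulti_linActMulti_symm {n : ℕ} (R : E4 ≃ₗᵢ[ℝ] E4) (F : 𝓢((Fin n → E4), ℂ)) :
    linActMulti R (linActMulti R.symm F) = F := by
  ext x
  simp only [linActMulti_apply, LinearIsometryEquiv.symm_symm, LinearIsometryEquiv.apply_symm_apply]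

/-- The axis cell with a ROTATED embedding: by exact covariance it is `latticeDist` tested against `R⁻¹ · F`. -/
theorem dist_axisCell_planeRot (L : ℕ) (β a θ : ℝ) (O : LGConfig 4 G → ℝ) (m : ℝ) (n : ℕ)
    (F : 𝓢((Fin n → E4), ℂ)) :
    (axisCell L).dist ρ β (fun x => planeRot (0 : Fin 3) θ (a • siteToE x)) O m n F =
      latticeDist ρ β L a O m n (linActMulti (planeRot (0 : Fin 3) θ).symm F) := by
  conv_lhs => rw [← linActMulti_linActMulti_symm (planeRot (0 : Fin 3) θ) F]
  rw [PeriodCell.dist_linActMulti, dist_axisCell]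

/-! ## §5 The costume check of the tilt split, in the kernel -/

section Costume

variable (G : Type) [Group G] [TopologicalSpace G] [IsTopologicalGroup G] [CompactSpace G]
  [MeasurableSpace G] [BorelSpace G] (r : LatticeRep G) (a : ℝ → ℝ)

/-- With the AXIS cell the tilt bracket (bracket 2) vanishes identically: `TI` for the axis cell is free. -/
theorem tiltInsensitivityOn_axisCell (S : Set ℕ) : TiltInsensitivityOn G r a axisCell S := by
  intro sch _ _ _ _
  refine ⟨1, one_pos, fun n _ F _ => ?_⟩
  simp only [mean_axisCell, dist_axisCell, sub_self]
  exact tendsto_const_nhds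

/-- With the AXIS cell the regularisation bracket (bracket 1) is LITERALLY King's defect at the angle `θ`:
`TiltedRegComparisonOn … axisCell θ S ↔ LatticeKingWardOn … {θ} S`.  Hence the split `KingOnClass ⇐ NROT3 ∧ TI` of
`BalabanLadderROTTiltSplit` degenerates to `KingOnClass ⇐ KING` on the axis cell and carries content only through a
genuinely skew (fitted, tilted) cell — the costume check, kernel form. -/
theorem tiltedRegComparisonOn_axisCell_iff (θ : ℝ) (S : Set ℕ) :
    TiltedRegComparisonOn G r a axisCell θ S ↔ LatticeKingWardOn G r a ({θ} : Set ℝ) S := by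
  constructor
  · exact fun h => latticeKingWardOn_of_tilt r a axisCell θ S h (tiltInsensitivityOn_axisCell G r a S)
  · intro hK sch hS hu hβ hr
    obtain ⟨r₀, hr₀, h⟩ := hK sch hS hu hβ hr
    refine ⟨r₀, hr₀, fun n hn F hF => ?_⟩
    have t := h n hn (linActMulti (planeRot (0 : Fin 3) θ).symm F)
      (King.linActMulti_mem_kingClass hF (planeRot (0 : Fin 3) θ).symm) θ (Set.mem_singleton θ)
    rw [linActMulti_linActMulti_symm] at t
    refine t.congr fun k => ?_
    rw [mean_axisCell, dist_axisCell_planeRot]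

end Costume

end Summit.QuantumFields.YangMills.Theorems.ROT

end
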